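import Summits.BirchSwinnertonDyer.BirchSwinnertonDyer.Theorems.CMKolyvaginAtInertTwoLowerSuppliesAtTwo
import Summits.BirchSwinnertonDyer.BirchSwinnertonDyer.Theorems.CMKolyvaginAtInertTwoLowerBottomRungAtTwo
import Summits.BirchSwinnertonDyer.BirchSwinnertonDyer.Theorems.CMKolyvaginAtInertTwoLowerSwapHybridAtTwo
import Summits.BirchSwinnertonDyer.BirchSwinnertonDyer.Theorems.GenusKolyvaginAtTwoPowDvdShaCardAtTwoRTEigenIndexSocket
import Summits.BirchSwinnertonDyer.BirchSwinnertonDyer.Theorems.GenusKolyvaginAtTwoPowDvdShaCardAtTwoRTLadderFrame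
import Summits.BirchSwinnertonDyer.BirchSwinnertonDyer.Theorems.GenusKolyvaginAtTwoPowDvdShaCardAtTwoRTGenusBudgetPrimeDisc
import Summits.BirchSwinnertonDyer.BirchSwinnertonDyer.Theorems.CMKolyvaginAtInertTwoShaCountHalvesAtTwo
import Summits.BirchSwinnertonDyer.BirchSwinnertonDyer.Theorems.Rank1ResidualJetRingClassFields
import HarnessLib

/-!
# Route `CMKolyvaginAtInertTwo`, crux `CMKolyvaginExactAtInertTwo` (stmt-BirchSwinnertonDyer-24277), `stub_lower` —
# PORT OF gk2's LINE 18, FILE D1: THE LOWER HALF `2^{2M₀} ≤ #Ш(E_K)[2^∞]` ON H₂ WITH PRIME `|d_K|` FROM A LEVEL-4 GROSS WITNESS,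
# modulo the route's four published inputs and Gross 1991 Prop. 3.7 (2)

Seat `bsd-line-cmk2-p1` g19 (cell `bsd-print-cf2`), `--supports stmt-BirchSwinnertonDyer-24277` (helper; closes nothing).
THEOREMS ONLY (no definition, no named fact, no `sorry`).  BSD is NOT proved by any of this; the crux is not closed here: the
registered `stub_lower` starts from the crux's SHALLOW certificate (`P(n) ∉ 2E(K[n])` at Kolyvagin primes of index `≥ 1` inert in `F`),
while the theorems below start from a level-`4` GROSS witness (index `≥ 2`, `Frob = Frob_∞` on `K(E[4])`, `addOrderOf c₂(e₀) = 4`) — the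
input of gk2's bottom rung; the passage shallow ⟹ deep on H₂ (gk2's stub W-UP; on H₂ every certificate prime is already a GROSS prime by
g3's bridge, so only the index/level upgrade remains) is NOT done here.

WHAT.
* `twinShaLadders_of_grossWitness` — the two ℚ-side Ш-ladders of gk2's stub L on H₂ from a level-`4` Gross witness: file B3's
  `twinShaLadders_of_deepSwap` with its three sockets SUPPLIED — `hbot` = file C1c's `hbot_socket_margin_of_three_le`, `hswap` = file C2b's
  `deepSwap_socket`, `hK` = gk2-p5's image-free `hK_socket_margin` (`Δ < 0` from the habitat).  Level `L ≥ 2M₀ + 12`, margin `k ≥ 1`.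
  Modulo Gross 3.7 (2) at `(W, K)` and `rank E(K) = 1` only (gk2's `twinShaLadders_of_grossWitness` needed `¬ HasCM`, `ρ_{2^∞}` onto,
  `PubInputsAtTwo`, (NPh)).
* `pow_le_card_mul_card_sha_two_of_grossWitness_of_facts` — `2^{2M₀} ≤ #Ш(E/ℚ)[2^∞] · #Ш(E^{(d_K)}/ℚ)[2^∞]` for PRIME `|d_K|`: the ladders
  fed to gk2-p3's image-free frame theorem `two_mul_le_padicValNat_add_of_shaLadders` (twin := the model `W.quadraticTwist d_K` itself), the
  genus budget `ord₂ C(W^{(d_K)}) = 1` for prime `|d_K|` (gk2-p2's `padicValNat_two_tamagawaProduct_twin_eq_one_of_prime`), finiteness of the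
  two Ш and `rank E(K) = 1` from GZ / GZK / modularity (g15, file B4).
* `pow_le_card_primaryComponent_sha_two_baseChange_of_grossWitness_of_printedInputs` — **the registered `stub_lower`'s CONCLUSION
  `2 ^ (2 * M₀) ≤ Nat.card (Ш(E_K)[2^∞])`** on H₂ with prime `|d_K|`, from the crux's frame binders (`y_K` non-torsion, `2^{M₀} ∥ P(1)`) and a
  level-`4` Gross witness, modulo GZ (24148) / GZK (19921) / modularity (19273) / Milne (24149) and `prop37_2_reductionCongruence_inert N_E W K`
  (g16's halves file `ShaCountTwo.pow_le_card_primaryComponent_sha_two_baseChange_of_le_pair_of_facts`).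
HONEST FRAMING: composition of the landed H₂ ports (files A–C2b) of gk2's LINE 18 and of gk2's image-free frame/budget theorems; closes
nothing; the twin upper half is g18's `KolyvaginPairSupplyTwo.card_primaryComponent_sha_two_baseChange_le_pow_of_printedInputs`.

References: [McCallumLMS1991] §5 Prop. 5.2, Thm. 5.4 (p. 310), Cor. 5.6; [Kolyvagin1991StructureSha]; [GrossLMS1991] Thm. 1.3, Prop. 3.7 (2);
[Kramer1981] §2 Prop. 3; [Milne1972ArithmeticAV] §1 Thm. 1.
-/

set_option autoImplicit false
-- the Theorems namespace of this sub repeats the summit name by design (D-0017 nested layout)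
set_option linter.dupNamespace false

noncomputable section

open scoped Classical

namespace Summit.BirchSwinnertonDyer.BirchSwinnertonDyer.Theorems.KolyvaginLowerTwo

open WeierstrassCurve NumberField IsDedekindDomain Field Literature.NumberTheory.EllipticCurves
  Literature.NumberTheory.GaloisRepresentations Literature.NumberTheory.EllipticCurves.ModularForms AddSubgroup
open Literature.NumberTheory.EllipticCurves.GrossLMS1991 (prop37_2_reductionCongruence_inert)
open Summit.BirchSwinnertonDyer.BirchSwinnertonDyer.Theorems.GenusExact
open Summit.BirchSwinnertonDyer.Rank1Residual

variable {K : Type} [Field K] [NumberField K]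

/-! ## §1 The two Ш-ladders on H₂ from a level-4 Gross witness -/

/-- **gk2's STUB L CONCLUSION (the two ℚ-side Ш-ladders) ON H₂ FROM A LEVEL-`4` GROSS WITNESS, modulo Gross 3.7 (2) at `(W, K)` and
`rank E(K) = 1`** — file B3's `twinShaLadders_of_deepSwap` over the margin-`k` class with the three sockets supplied (C1c `hbot_socket_margin_of_three_le`,
C2b `deepSwap_socket`, gk2-p5 `hK_socket_margin`).  Level `L ≥ 2M₀ + 12`, depth `k ≥ 1`; witness: `n₀` square-free of Zhang–Kolyvagin primes of
index `≥ 2` with `FrobEqFrobInfty W K 4`, a datum `e₀` with `addOrderOf c₂(e₀) = 4`.  gk2-p3 g24's `twinShaLadders_of_grossWitness` on the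
CM-inert habitat. [cite: McCallumLMS1991, §5 Prop. 5.2, Thm. 5.4] [cite: GrossLMS1991, Thm. 1.3, Prop. 3.7 (2), §4 (4.1), Prop. 5.3] -/
theorem twinShaLadders_of_grossWitness
    (W : WeierstrassCurve ℚ) [W.IsElliptic] [W.IsGloballyMinimal] [NeZero (W.conductorNorm ℤ)]
    (hCM : W.HasCM) (hin : Rank1Residual.CMInert W 2) (hρ2 : W.HasSurjectiveModNGaloisRep 2)
    (hT : Odd W.tamagawaProduct) (K : Type) [Field K] [NumberField K] (hIQ : IsImaginaryQuadratic K)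
    (hodd : Odd (NumberField.discr K)) (h3 : NumberField.discr K ≠ -3) (hHe : SatisfiesHeegnerHypothesis (W.conductorNorm ℤ) K)
    (h37 : prop37_2_reductionCongruence_inert (W.conductorNorm ℤ) W K)
    (Dt : ModularParametrizationData W (W.conductorNorm ℤ)) (β : ℤ) (ι : K →+* ℂ) (d₁ : KolyvaginHeegnerData Dt β ι 1)
    (hy : ¬ IsOfFinAddOrder d₁.derivedPoint) (hrk1 : (W.baseChange K).mordellWeilRank = 1) (M₀ : ℕ)
    (hM₀ : ∃ Q : (W.baseChange (ringClassField K ι 1)).toAffine.Point, ((2 ^ M₀ : ℕ) : ℤ) • Q = d₁.derivedPoint)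
    (hndiv : ¬ ∃ Q : (W.baseChange (ringClassField K ι 1)).toAffine.Point, ((2 ^ (M₀ + 1) : ℕ) : ℤ) • Q = d₁.derivedPoint)
    (Wd : WeierstrassCurve ℚ) [Wd.IsElliptic] (hTw : ∃ C : VariableChange ℚ, C • W.quadraticTwist (NumberField.discr K : ℚ) = Wd)
    {L k : ℕ} (hL : 2 * M₀ + 12 ≤ L) (hk : 1 ≤ k)
    {n₀ : ℕ} (hn₀ : Squarefree n₀)
    (hn₀K : ∀ q ∈ n₀.primeFactors, Zhang2014.IsKolyvaginPrime (W.conductorNorm ℤ) W K 2 q ∧ 2 ≤ Zhang2014.kolyvaginIndex W 2 q ∧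
      FrobEqFrobInfty W K (2 ^ 2) q)
    (e₀ : KolyvaginHeegnerData Dt β ι n₀) (he₀ : addOrderOf (e₀.kolyvaginClass Nat.prime_two 2) = 2 ^ 2) :
    ∃ (T : ℕ) (M : ℕ → ℕ), (∀ j, M (j + 1) ≤ M j) ∧ M 0 = M₀ ∧ M (2 * T) = 0 ∧
      (∀ m < T, ∃ x : Fin (2 * m + 2) → W.galH1, (∀ i, resBaseChange W K (x i) ∈ (W.baseChange K).sha) ∧
        (∀ i, addOrderOf (x i) = 2 ^ (M (2 * m) - M (2 * m + 1))) ∧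
        ∀ c : Fin (2 * m + 2) → ℤ, ∑ i, c i • x i = 0 → ∀ i, ((2 ^ (M (2 * m) - M (2 * m + 1)) : ℕ) : ℤ) ∣ c i) ∧
      (∀ m < T, ∃ x : Fin (2 * m + 2) → Wd.galH1, (∀ i, resBaseChange Wd K (x i) ∈ (Wd.baseChange K).sha) ∧
        (∀ i, addOrderOf (x i) = 2 ^ (M (2 * m + 1) - M (2 * m + 2))) ∧
        ∀ c : Fin (2 * m + 2) → ℤ, ∑ i, c i • x i = 0 → ∀ i, ((2 ^ (M (2 * m + 1) - M (2 * m + 2)) : ℕ) : ℤ) ∣ c i) := by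
  haveI : ∀ j : ℕ, NumberField (ringClassField K ι j) := JET.numberField_ringClassField K hIQ ι
  have hΔ : W.Δ < 0 := KolyvaginEigenTwo.Δ_neg_of_cmInert_two W hCM hin hρ2
  exact twinShaLadders_of_deepSwap W hCM hin hρ2 hT K hIQ hodd h3 hHe h37 Dt β ι d₁ hy hrk1 M₀ hM₀ hndiv Wd hTw (L := L)
    (by omega) k (fun q ↦ L + k ≤ Zhang2014.kolyvaginIndex W 2 q ∧ FrobEqFrobInfty W K (2 ^ (L + k)) q)
    (fun q _ hidx hF ↦ ⟨hidx, hF⟩)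
    (hbot_socket_margin_of_three_le W hCM hin hρ2 hT hIQ hodd h3 hHe h37 Dt β ι (L := L) (by omega) k (by omega) _
      (fun q _ hidx hF ↦ ⟨hidx, hF⟩) hn₀ hn₀K e₀ he₀)
    (fun τ hτ ↦ deepSwap_socket W hCM hin hT hρ2 hIQ hodd h3 hHe h37 τ hτ Dt β ι hL hk)
    (fun τ hτ r ℓ hℓ C hC ↦ PlusDescent.hK_socket_margin W hΔ hIQ hτ (L := L) (by omega) r k ℓ hℓ C hC)

/-! ## §2 The lower half for the ℚ-pair, prime `|d_K|` -/

/-- **`2^{2M₀} ≤ #Ш(E/ℚ)[2^∞] · #Ш(E^{(d_K)}/ℚ)[2^∞]` ON H₂ WITH PRIME `|d_K|` FROM A LEVEL-`4` GROSS WITNESS** (McCallum's Thm. 5.4 "≥"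
transported to the ℚ-pair, the twist taken in the model `W.quadraticTwist d_K`), modulo GZ / GZK / modularity (ranks and finiteness of the two
Ш, `rank E(K) = 1`) and Gross 3.7 (2) at `(W, K)`: the ladders of §1 at `L := 2M₀ + 12`, `k := 1`, fed to gk2-p3's image-free frame theorem
`two_mul_le_padicValNat_add_of_shaLadders` with the one-bit genus budget `ord₂ C(W^{(d_K)}) = 1` of a prime Heegner discriminant
(`padicValNat_two_tamagawaProduct_twin_eq_one_of_prime`), then `2^{v₂ a} ∣ a`.
[cite: McCallumLMS1991, §5 Prop. 5.2, Thm. 5.4 (p. 310), Cor. 5.6] [cite: Kramer1981, §2 Prop. 3] [cite: GrossLMS1991, Thm. 1.3] -/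
theorem pow_le_card_mul_card_sha_two_of_grossWitness_of_facts
    (hGZ : ∀ (N : ℕ) [NeZero N] (W : WeierstrassCurve ℚ) (K : Type) [Field K] [NumberField K], gross_zagier N W K)
    (hGZK : rank_eq_analyticRank_of_analyticRank_le_one) (hmod : hasEntireLFunction_rat)
    (W : WeierstrassCurve ℚ) [W.IsElliptic] [W.IsGloballyMinimal] [NeZero (W.conductorNorm ℤ)]
    (hCM : W.HasCM) (hin : Rank1Residual.CMInert W 2) (hρ2 : W.HasSurjectiveModNGaloisRep 2)
    (hT : Odd W.tamagawaProduct) (K : Type) [Field K] [NumberField K] (hIQ : IsImaginaryQuadratic K)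
    (hodd : Odd (NumberField.discr K)) (h3 : NumberField.discr K ≠ -3) (hq : (NumberField.discr K).natAbs.Prime)
    (hHe : SatisfiesHeegnerHypothesis (W.conductorNorm ℤ) K)
    (h37 : prop37_2_reductionCongruence_inert (W.conductorNorm ℤ) W K)
    (Dt : ModularParametrizationData W (W.conductorNorm ℤ)) (β : ℤ) (ι : K →+* ℂ) (d₁ : KolyvaginHeegnerData Dt β ι 1)
    (hy : ¬ IsOfFinAddOrder d₁.derivedPoint) (M₀ : ℕ)
    (hM₀ : ∃ Q : (W.baseChange (ringClassField K ι 1)).toAffine.Point, ((2 ^ M₀ : ℕ) : ℤ) • Q = d₁.derivedPoint)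
    (hndiv : ¬ ∃ Q : (W.baseChange (ringClassField K ι 1)).toAffine.Point, ((2 ^ (M₀ + 1) : ℕ) : ℤ) • Q = d₁.derivedPoint)
    {n₀ : ℕ} (hn₀ : Squarefree n₀)
    (hn₀K : ∀ q ∈ n₀.primeFactors, Zhang2014.IsKolyvaginPrime (W.conductorNorm ℤ) W K 2 q ∧ 2 ≤ Zhang2014.kolyvaginIndex W 2 q ∧
      FrobEqFrobInfty W K (2 ^ 2) q)
    (e₀ : KolyvaginHeegnerData Dt β ι n₀) (he₀ : addOrderOf (e₀.kolyvaginClass Nat.prime_two 2) = 2 ^ 2) :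
    2 ^ (2 * M₀) ≤ Nat.card (AddCommGroup.primaryComponent W.sha 2) *
      Nat.card (AddCommGroup.primaryComponent (W.quadraticTwist (NumberField.discr K : ℚ)).sha 2) := by
  have hD0 : (NumberField.discr K : ℚ) ≠ 0 := by exact_mod_cast NumberField.discr_ne_zero K
  haveI hEt : (W.quadraticTwist (NumberField.discr K : ℚ)).IsElliptic := W.isElliptic_quadraticTwist hD0
  have hΔ : W.Δ < 0 := KolyvaginEigenTwo.Δ_neg_of_cmInert_two W hCM hin hρ2
  have hTw : ∃ C : VariableChange ℚ, C • W.quadraticTwist (NumberField.discr K : ℚ) = W.quadraticTwist (NumberField.discr K : ℚ) :=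
    ⟨1, one_smul _ _⟩
  -- ranks and finiteness from the published inputs
  have hrk1 : (W.baseChange K).mordellWeilRank = 1 :=
    mordellWeilRank_baseChange_eq_one_of_facts hGZ hGZK hmod W K hIQ hHe Dt β ι d₁ hy
  obtain ⟨-, hfinW, hfinD⟩ := ShaCountTwo.rank_add_eq_one_and_finite_sha_of_heegnerData_of_facts hGZ hGZK hmod W K hIQ hHe Dt β ι d₁ hy
    (W.quadraticTwist (NumberField.discr K : ℚ)) hTw
  haveI := hfinW
  haveI := hfinD
  have hg : 0 < Nat.card (AddCommGroup.primaryComponent W.sha 2) := Nat.card_pos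
  have hg' : 0 < Nat.card (AddCommGroup.primaryComponent (W.quadraticTwist (NumberField.discr K : ℚ)).sha 2) := Nat.card_pos
  -- the ladders at `L := 2M₀ + 12`, `k := 1`
  obtain ⟨T, M, hM, hM0, hMT, hfam, hfam'⟩ := twinShaLadders_of_grossWitness W hCM hin hρ2 hT K hIQ hodd h3 hHe h37 Dt β ι d₁ hy hrk1
    M₀ hM₀ hndiv (W.quadraticTwist (NumberField.discr K : ℚ)) hTw (L := 2 * M₀ + 12) (k := 1) le_rfl le_rfl hn₀ hn₀K e₀ he₀
  -- the frame theorem and the one-bit genus budget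
  have hframe := PlusDescent.two_mul_le_padicValNat_add_of_shaLadders W K hΔ hT hIQ hodd hHe 1 (one_smul _ _) hg hg' T M hM hMT
    hfam hfam'
  have hB : padicValNat 2 (W.quadraticTwist (NumberField.discr K : ℚ)).tamagawaProduct = 1 :=
    PlusDescent.padicValNat_two_tamagawaProduct_twin_eq_one_of_prime W hIQ hodd hHe hT hΔ hq 1 (one_smul _ _)
  rw [hM0, hB] at hframe
  set a := padicValNat 2 (Nat.card (AddCommGroup.primaryComponent W.sha 2)) with ha
  set b := padicValNat 2 (Nat.card (AddCommGroup.primaryComponent (W.quadraticTwist (NumberField.discr K : ℚ)).sha 2)) with hb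
  have hab : 2 * M₀ ≤ a + b := by omega
  -- `2^{v₂ n} ∣ n`
  have hA : 2 ^ a ≤ Nat.card (AddCommGroup.primaryComponent W.sha 2) := Nat.le_of_dvd hg pow_padicValNat_dvd
  have hBd : 2 ^ b ≤ Nat.card (AddCommGroup.primaryComponent (W.quadraticTwist (NumberField.discr K : ℚ)).sha 2) :=
    Nat.le_of_dvd hg' pow_padicValNat_dvd
  calc 2 ^ (2 * M₀) ≤ 2 ^ (a + b) := Nat.pow_le_pow_right (by norm_num) hab
    _ = 2 ^ a * 2 ^ b := pow_add 2 a b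
    _ ≤ _ := Nat.mul_le_mul hA hBd

/-! ## §3 The registered `stub_lower`'s conclusion on H₂ with prime `|d_K|`, from a level-4 Gross witness -/

/-- **`stub_lower`'s CONCLUSION `2^{2M₀} ≤ #Ш(E_K)[2^∞]` ON H₂ WITH PRIME `|d_K|`, FROM A LEVEL-`4` GROSS WITNESS, modulo the route's
published inputs GZ (24148) / GZK (19921) / modularity (19273) / Milne (24149) and Gross 1991 Prop. 3.7 (2) at `(W, K)`** — §2 transported to
`K` by g16's halves file (`ShaCountTwo.pow_le_card_primaryComponent_sha_two_baseChange_of_le_pair_of_facts`, the count identity of g15).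
Frame binders as in the crux (`W` CM, `CMInert W 2`, `ρ̄₂` onto, odd Tamagawa; `K` imaginary quadratic, odd `d_K ≠ −3`, Heegner; `y_K = P(1)`
of infinite order, `2^{M₀} ∥ P(1)` in `E(K[1])`); the crux's shallow certificate is REPLACED by the level-`4` Gross witness `(n₀, e₀)`.
Twin of g18's upper half `KolyvaginPairSupplyTwo.card_primaryComponent_sha_two_baseChange_le_pow_of_printedInputs`.
[cite: McCallumLMS1991, §5 Prop. 5.2, Thm. 5.4 "≥" (p. 310)] [cite: Milne1972ArithmeticAV, §1 Thm. 1] [cite: GrossLMS1991, Prop. 3.7 (2)] -/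
theorem pow_le_card_primaryComponent_sha_two_baseChange_of_grossWitness_of_printedInputs
    (hGZ : ∀ (N : ℕ) [NeZero N] (W : WeierstrassCurve ℚ) (K : Type) [Field K] [NumberField K], gross_zagier N W K)
    (hGZK : rank_eq_analyticRank_of_analyticRank_le_one) (hmod : hasEntireLFunction_rat)
    (hMilneC : Milne1972.bsdQuotient_baseChange_quadratic_anyModel)
    (W : WeierstrassCurve ℚ) [W.IsElliptic] [W.IsGloballyMinimal] [NeZero (W.conductorNorm ℤ)]
    (hCM : W.HasCM) (hin : Rank1Residual.CMInert W 2) (hρ2 : W.HasSurjectiveModNGaloisRep 2)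
    (hT : Odd W.tamagawaProduct) (K : Type) [Field K] [NumberField K] (hIQ : IsImaginaryQuadratic K)
    (hodd : Odd (NumberField.discr K)) (h3 : NumberField.discr K ≠ -3) (hq : (NumberField.discr K).natAbs.Prime)
    (hHe : SatisfiesHeegnerHypothesis (W.conductorNorm ℤ) K)
    (h37 : prop37_2_reductionCongruence_inert (W.conductorNorm ℤ) W K)
    (Dt : ModularParametrizationData W (W.conductorNorm ℤ)) (β : ℤ) (ι : K →+* ℂ) (d₁ : KolyvaginHeegnerData Dt β ι 1)
    (hy : ¬ IsOfFinAddOrder d₁.derivedPoint) (M₀ : ℕ)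
    (hM₀ : ∃ Q : (W.baseChange (ringClassField K ι 1)).toAffine.Point, ((2 ^ M₀ : ℕ) : ℤ) • Q = d₁.derivedPoint)
    (hndiv : ¬ ∃ Q : (W.baseChange (ringClassField K ι 1)).toAffine.Point, ((2 ^ (M₀ + 1) : ℕ) : ℤ) • Q = d₁.derivedPoint)
    {n₀ : ℕ} (hn₀ : Squarefree n₀)
    (hn₀K : ∀ q ∈ n₀.primeFactors, Zhang2014.IsKolyvaginPrime (W.conductorNorm ℤ) W K 2 q ∧ 2 ≤ Zhang2014.kolyvaginIndex W 2 q ∧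
      FrobEqFrobInfty W K (2 ^ 2) q)
    (e₀ : KolyvaginHeegnerData Dt β ι n₀) (he₀ : addOrderOf (e₀.kolyvaginClass Nat.prime_two 2) = 2 ^ 2) :
    2 ^ (2 * M₀) ≤ Nat.card (AddCommGroup.primaryComponent (W.baseChange K).sha 2) :=
  ShaCountTwo.pow_le_card_primaryComponent_sha_two_baseChange_of_le_pair_of_facts hGZ hGZK hmod hMilneC W hCM hin hρ2 K hIQ hodd hHe
    hq Dt β ι d₁ hy
    (pow_le_card_mul_card_sha_two_of_grossWitness_of_facts hGZ hGZK hmod W hCM hin hρ2 hT K hIQ hodd h3 hq hHe h37 Dt β ι d₁ hy M₀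
      hM₀ hndiv hn₀ hn₀K e₀ he₀)

end Summit.BirchSwinnertonDyer.BirchSwinnertonDyer.Theorems.KolyvaginLowerTwo

end
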